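import Summits.Ventures.PercRepro.Night2LocalD3TwoOneA

/-!
# PercRepro — the cell `(a, k) = (2, 1)` at `|E ∖ G| = 3`, `q = 4`: the fat pair members and the layer-1 requests (night-2, gen 13)

At a far set `S` with `coloops S = K ∪ {x}` (`K = {y}`), `|S| = 6`, non-coloops `T'` (four points):

* **three fat pair members inside one covering set `S ∖ t` are impossible** (`not_three_fat_in_erase`): the three closures meet in
  `cl(coloops S) = cl(K ∪ {x})` inside the independent `S ∖ t`, so a point of `G ∖ S` would lie in `cl {x}`;
* **two fat pair members kill the preimage `S ∖ x`** (`not_erase_mem_Uq_of_two_fat_pairs`): `ρ(cl B₁ ∩ cl B₂) ≤ 8 − ρ(B₁ ∪ B₂) = 3`,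
  hence `ρ({x} ∪ (G ∖ S)) ≤ 2` and `E ∖ (S ∖ x)` has rank `≤ 5`;
* `L₁(S) ≤ [S ∖ x member] · req(S ∖ x)` (`L1_le_req_erase_one`);
* the deletions `(S ∖ v) ∖ t` (`v ≠ t` non-coloops) contain `coloops S` (`pair_shape_of_erase_erase'`).
-/

open scoped Matroid

namespace PercRepro.Shadow

open Finset PerFlat ThmH

variable {α : Type*} [DecidableEq α] {M : Matroid α} [M.Finite]

section TwoOneB

variable {G S : Finset α}

/-- The deletions `(S ∖ v) ∖ t` of two distinct non-coloops contain `coloops S`, lie in `S`, and miss exactly `{v, t}`. -/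
theorem pair_shape_of_erase_erase' {v t : α} (hv : v ∈ nonColoops M S) (ht : t ∈ nonColoops M S) (hvt : v ≠ t) :
    coloops M S ⊆ (S.erase v).erase t ∧ (S.erase v).erase t ⊆ S ∧ (S \ (S.erase v).erase t).card = 2 := by
  have hvS : v ∈ S := (mem_nonColoops.1 hv).1
  have htS : t ∈ S := (mem_nonColoops.1 ht).1
  refine ⟨?_, (Finset.erase_subset _ _).trans (Finset.erase_subset _ _), ?_⟩
  · intro e he
    rw [Finset.mem_erase, Finset.mem_erase]
    exact ⟨fun h => (mem_nonColoops.1 ht).2 (h ▸ he), fun h => (mem_nonColoops.1 hv).2 (h ▸ he), coloops_subset_self S he⟩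
  · have : S \ (S.erase v).erase t = {v, t} := by
      ext e
      rw [Finset.mem_sdiff, Finset.mem_erase, Finset.mem_erase, Finset.mem_insert, Finset.mem_singleton]
      constructor
      · rintro ⟨heS, h⟩
        by_cases hev : e = v
        · exact Or.inl hev
        · right
          by_contra het
          exact h ⟨het, hev, heS⟩
      · rintro (rfl | rfl)
        · exact ⟨hvS, fun h => h.2.1 rfl⟩
        · exact ⟨htS, fun h => h.1 rfl⟩
    rw [this, Finset.card_pair hvt]

open scoped Classical in
/-- **Three fat pair members inside one covering set are impossible** (`coloops S = K ∪ {x}`, `|S| = 6`). -/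
theorem not_three_fat_in_erase (hs : ∀ e ∈ gr M, ∀ f ∈ gr M, e ≠ f → rkN M {e, f} = 2) (hG : G ∈ flatsQ M (4 + 1))
    (hS : S ∈ shadowAt M (4 + 2) 4 (Uq M (4 + 2) 4) G) (hS6 : S.card = 6)
    (ha : (coloops M S).card = 2) {x : α} (hxK : x ∉ G.filter (fun y => y ∉ clF M (G.erase y)))
    (hcol : coloops M S = insert x (G.filter (fun y => y ∉ clF M (G.erase y)))) {t : α} (ht : t ∈ nonColoops M S)
    (hP : ∃ p ∈ G, p ∉ S) {B₁ B₂ B₃ : Finset α}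
    (hc₁ : coloops M S ⊆ B₁) (hc₂ : coloops M S ⊆ B₂) (hc₃ : coloops M S ⊆ B₃)
    (h₁ : B₁ ⊆ S.erase t) (h₂ : B₂ ⊆ S.erase t) (h₃ : B₃ ⊆ S.erase t)
    (hk₁ : (S \ B₁).card = 2) (hk₂ : (S \ B₂).card = 2) (hk₃ : (S \ B₃).card = 2)
    (h12 : B₁ ≠ B₂) (h13 : B₁ ≠ B₃) (h23 : B₂ ≠ B₃)
    (hf₁ : G \ S ⊆ clF M B₁) (hf₂ : G \ S ⊆ clF M B₂) (hf₃ : G \ S ⊆ clF M B₃) : False := by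
  set K := G.filter (fun y => y ∉ clF M (G.erase y)) with hKdef
  have hGg : G ⊆ gr M := (mem_flatsQ.1 hG).1
  have hSG : S ⊆ G := subset_of_mem_shadowAt hS
  have hI : M.Indep ((S.erase t : Finset α) : Set α) := indep_erase_of_mem_nonColoops hG hS hS6 ht
  have hxc : x ∈ coloops M S := by rw [hcol]; exact Finset.mem_insert_self _ _
  have hxS : x ∈ S := coloops_subset_self S hxc
  -- the three pairs `S ∖ Bᵢ` all contain `t`; their other points are three distinct non-coloops
  have htB : ∀ {B : Finset α}, B ⊆ S.erase t → t ∉ B := fun hB h => (Finset.mem_erase.1 (hB h)).1 rfl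
  have hT4 : (nonColoops M S).card = 4 := by
    have := Finset.card_sdiff_add_card_eq_card (coloops_subset_self (M := M) S)
    unfold nonColoops; omega
  -- the triple intersection is `coloops S`
  have hinter : B₁ ∩ B₂ ∩ B₃ = coloops M S := by
    apply Finset.eq_of_subset_of_card_le
    · intro e he
      rw [Finset.mem_inter, Finset.mem_inter] at he
      by_contra hec
      have heS : e ∈ S := (Finset.mem_erase.1 (h₁ he.1.1)).2
      have heT : e ∈ nonColoops M S := mem_nonColoops.2 ⟨heS, hec⟩
      have het : e ≠ t := (Finset.mem_erase.1 (h₁ he.1.1)).1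
      -- the four non-coloops are `t` and the three "other points" `(S ∖ Bᵢ) ∖ t`
      have hpt : ∀ {B : Finset α}, coloops M S ⊆ B → B ⊆ S.erase t → (S \ B).card = 2 → ((S \ B).erase t).card = 1 := by
        intro B hc hB hk
        rw [Finset.card_erase_of_mem (Finset.mem_sdiff.2 ⟨(mem_nonColoops.1 ht).1, htB hB⟩), hk]
      obtain ⟨t₁, ht₁⟩ := Finset.card_eq_one.1 (hpt hc₁ h₁ hk₁)
      obtain ⟨t₂, ht₂⟩ := Finset.card_eq_one.1 (hpt hc₂ h₂ hk₂)
      obtain ⟨t₃, ht₃⟩ := Finset.card_eq_one.1 (hpt hc₃ h₃ hk₃)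
      have hmem : ∀ {B : Finset α} {u : α}, (S \ B).erase t = {u} → u ∈ S \ B ∧ u ≠ t := by
        intro B u hu
        have : u ∈ (S \ B).erase t := by rw [hu]; exact Finset.mem_singleton_self u
        exact ⟨(Finset.mem_erase.1 this).2, (Finset.mem_erase.1 this).1⟩
      have hsub : insert t {t₁, t₂, t₃} ⊆ nonColoops M S := by
        intro u hu
        simp only [Finset.mem_insert, Finset.mem_singleton] at hu
        rcases hu with rfl | rfl | rfl | rfl
        · exact ht
        · exact mem_nonColoops.2 ⟨(Finset.mem_sdiff.1 (hmem ht₁).1).1,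
            fun h => (Finset.mem_sdiff.1 (hmem ht₁).1).2 (hc₁ h)⟩
        · exact mem_nonColoops.2 ⟨(Finset.mem_sdiff.1 (hmem ht₂).1).1,
            fun h => (Finset.mem_sdiff.1 (hmem ht₂).1).2 (hc₂ h)⟩
        · exact mem_nonColoops.2 ⟨(Finset.mem_sdiff.1 (hmem ht₃).1).1,
            fun h => (Finset.mem_sdiff.1 (hmem ht₃).1).2 (hc₃ h)⟩
      -- the pairs are distinct, so the `tᵢ` are distinct
      have hpair : ∀ {B : Finset α} {u : α}, B ⊆ S.erase t → (S \ B).card = 2 → (S \ B).erase t = {u} → S \ B = {t, u} := by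
        intro B u hB hk hu
        have htm : t ∈ S \ B := Finset.mem_sdiff.2 ⟨(mem_nonColoops.1 ht).1, htB hB⟩
        rw [← Finset.insert_erase htm, hu]
      have hne : ∀ {B B' : Finset α} {u u' : α}, B ⊆ S → B' ⊆ S → S \ B = {t, u} → S \ B' = {t, u'} → B ≠ B' → u ≠ u' := by
        intro B B' u u' hB hB' hu hu' hBB' huu'
        apply hBB'
        calc B = S \ (S \ B) := (Finset.sdiff_sdiff_eq_self hB).symm
          _ = S \ (S \ B') := by rw [hu, hu', huu']
          _ = B' := Finset.sdiff_sdiff_eq_self hB'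
      have hS₁ : B₁ ⊆ S := h₁.trans (Finset.erase_subset _ _)
      have hS₂ : B₂ ⊆ S := h₂.trans (Finset.erase_subset _ _)
      have hS₃ : B₃ ⊆ S := h₃.trans (Finset.erase_subset _ _)
      have hP₁ := hpair h₁ hk₁ ht₁
      have hP₂ := hpair h₂ hk₂ ht₂
      have hP₃ := hpair h₃ hk₃ ht₃
      have h12' : t₁ ≠ t₂ := hne hS₁ hS₂ hP₁ hP₂ h12
      have h13' : t₁ ≠ t₃ := hne hS₁ hS₃ hP₁ hP₃ h13
      have h23' : t₂ ≠ t₃ := hne hS₂ hS₃ hP₂ hP₃ h23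
      have hcard4 : (insert t {t₁, t₂, t₃} : Finset α).card = 4 := by
        rw [Finset.card_insert_of_notMem, Finset.card_insert_of_notMem, Finset.card_pair h23']
        · rw [Finset.mem_insert, Finset.mem_singleton]; rintro (h | h); exact h12' h; exact h13' h
        · simp only [Finset.mem_insert, Finset.mem_singleton]
          rintro (h | h | h)
          · exact (hmem ht₁).2 h.symm
          · exact (hmem ht₂).2 h.symm
          · exact (hmem ht₃).2 h.symm
      have heq : insert t {t₁, t₂, t₃} = nonColoops M S := Finset.eq_of_subset_of_card_le hsub (by omega)
      rw [← heq] at heT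
      simp only [Finset.mem_insert, Finset.mem_singleton] at heT
      rcases heT with h | h | h | h
      · exact het h
      · exact (Finset.mem_sdiff.1 (hmem ht₁).1).2 (h ▸ he.1.1)
      · exact (Finset.mem_sdiff.1 (hmem ht₂).1).2 (h ▸ he.1.2)
      · exact (Finset.mem_sdiff.1 (hmem ht₃).1).2 (h ▸ he.2)
    · apply Finset.card_le_card
      intro e he
      exact Finset.mem_inter.2 ⟨Finset.mem_inter.2 ⟨hc₁ he, hc₂ he⟩, hc₃ he⟩
  -- a point of `G ∖ S` lies in `cl(coloops S) = cl(K ∪ {x})`, hence in `cl {x}`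
  obtain ⟨p, hpG, hpS⟩ := hP
  have hp : p ∈ G \ S := Finset.mem_sdiff.2 ⟨hpG, hpS⟩
  have hp12 : p ∈ clF M (B₁ ∩ B₂) := mem_clF_inter_of_indep hI h₁ h₂ (hf₁ hp) (hf₂ hp)
  have hp123 : p ∈ clF M (B₁ ∩ B₂ ∩ B₃) :=
    mem_clF_inter_of_indep hI (Finset.inter_subset_left.trans h₁) h₃ hp12 (hf₃ hp)
  rw [hinter, hcol] at hp123
  have hpK : p ∉ K := fun h => hpS (coloops_subset_self S (coloopsG_subset_coloops hS h))
  have hxG : x ∈ G := hSG hxS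
  have hp' : p ∈ clF M (insert x (insert x K)) := by rwa [Finset.insert_eq_of_mem (Finset.mem_insert_self x K)]
  have hpx : p ∈ clF M {x, x} := mem_clF_pair_of_mem_clF_coloops hG hxG hxG hpG hxK hxK hpK hp'
  rw [Finset.insert_eq_of_mem (Finset.mem_singleton_self x)] at hpx
  have hrk : rkN M (insert p {x}) ≤ rkN M {x} :=
    rkN_insert_le_of_mem_clF (Finset.singleton_subset_iff.2 (hGg hxG)) hpx
  have h1 : rkN M {x} ≤ 1 := (rkN_le_card _).trans (by simp)
  have hpx' : p ≠ x := fun h => hpS (h ▸ hxS)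
  have h2 : rkN M {p, x} = 2 := hs p (hGg hpG) x (hGg hxG) hpx'
  rw [show insert p ({x} : Finset α) = {p, x} from rfl] at hrk
  omega

open scoped Classical in
/-- **Two fat pair members kill the preimage `S ∖ x`**: `ρ(cl B₁ ∩ cl B₂) ≤ 3` by submodularity, so `ρ({x} ∪ (G ∖ S)) ≤ 2`. -/
theorem not_erase_mem_Uq_of_two_fat_pairs (hG : G ∈ flatsQ M (4 + 1)) (hd : (gr M \ G).card = 3)
    (hk : kColoops M G = 1) (hS : S ∈ shadowAt M (4 + 2) 4 (Uq M (4 + 2) 4) G) {x : α}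
    (hxK : x ∉ G.filter (fun y => y ∉ clF M (G.erase y)))
    (hcol : coloops M S = insert x (G.filter (fun y => y ∉ clF M (G.erase y)))) {B₁ B₂ : Finset α}
    (hB₁ : B₁ ∈ membersIn M (Uq M (4 + 2) 4) G) (hB₂ : B₂ ∈ membersIn M (Uq M (4 + 2) 4) G)
    (hc₁ : coloops M S ⊆ B₁) (hc₂ : coloops M S ⊆ B₂) (hB₁S : B₁ ⊆ S) (hB₂S : B₂ ⊆ S)
    (hk₁ : (S \ B₁).card = 2) (hk₂ : (S \ B₂).card = 2) (hne : B₁ ≠ B₂)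
    (hf₁ : G \ S ⊆ clF M B₁) (hf₂ : G \ S ⊆ clF M B₂) : S.erase x ∉ Uq M (4 + 2) 4 := by
  set K := G.filter (fun y => y ∉ clF M (G.erase y)) with hKdef
  have hGg : G ⊆ gr M := (mem_flatsQ.1 hG).1
  have hSG : S ⊆ G := subset_of_mem_shadowAt hS
  have hSg : S ⊆ gr M := hSG.trans hGg
  have hKc : K.card = 1 := by unfold kColoops at hk; rw [← hKdef] at hk; exact hk
  have hxc : x ∈ coloops M S := by rw [hcol]; exact Finset.mem_insert_self _ _
  have hxS : x ∈ S := coloops_subset_self S hxc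
  have hr₁ : rkN M B₁ = 4 := by
    have h := (mem_Uq.1 (mem_membersIn.1 hB₁).1).2.1
    rw [eRk_eq_rkN] at h; exact_mod_cast h
  have hr₂ : rkN M B₂ = 4 := by
    have h := (mem_Uq.1 (mem_membersIn.1 hB₂).1).2.1
    rw [eRk_eq_rkN] at h; exact_mod_cast h
  -- `ρ(B₁ ∪ B₂) ≥ 5`
  have hunion : 5 ≤ rkN M (B₁ ∪ B₂) := by
    have hsub : S \ (B₁ ∪ B₂) ⊆ (S \ B₁) ∩ (S \ B₂) := by
      intro e he
      rw [Finset.mem_sdiff, Finset.mem_union, not_or] at he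
      exact Finset.mem_inter.2 ⟨Finset.mem_sdiff.2 ⟨he.1, he.2.1⟩, Finset.mem_sdiff.2 ⟨he.1, he.2.2⟩⟩
    have hPne : S \ B₁ ≠ S \ B₂ := by
      intro h
      apply hne
      calc B₁ = S \ (S \ B₁) := (Finset.sdiff_sdiff_eq_self hB₁S).symm
        _ = S \ (S \ B₂) := by rw [h]
        _ = B₂ := Finset.sdiff_sdiff_eq_self hB₂S
    have hint1 : ((S \ B₁) ∩ (S \ B₂)).card ≤ 1 := by
      by_contra hlt
      push Not at hlt
      have heq : (S \ B₁) ∩ (S \ B₂) = S \ B₁ :=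
        Finset.eq_of_subset_of_card_le Finset.inter_subset_left (by omega)
      have heq' : (S \ B₁) ∩ (S \ B₂) = S \ B₂ :=
        Finset.eq_of_subset_of_card_le Finset.inter_subset_right (by omega)
      exact hPne (heq.symm.trans heq')
    have hcard := (Finset.card_le_card hsub).trans hint1
    by_cases hemp : S \ (B₁ ∪ B₂) = ∅
    · have : S ⊆ B₁ ∪ B₂ := Finset.sdiff_eq_empty_iff_subset.1 hemp
      have := rkN_mono (M := M) this
      rw [rkN_eq_of_mem_shadowAt hS] at this
      exact this
    · obtain ⟨t, ht⟩ := Finset.nonempty_iff_ne_empty.2 hemp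
      have hsing : S \ (B₁ ∪ B₂) = {t} := by
        apply Finset.eq_of_subset_of_card_le
        · intro e he
          rw [Finset.mem_singleton]
          by_contra hne'
          have : 2 ≤ (S \ (B₁ ∪ B₂)).card := by
            have h2 : ({e, t} : Finset α) ⊆ S \ (B₁ ∪ B₂) := by
              intro u hu
              rw [Finset.mem_insert, Finset.mem_singleton] at hu
              rcases hu with rfl | rfl
              · exact he
              · exact ht
            have := Finset.card_le_card h2
            rwa [Finset.card_pair hne'] at this
          omega
        · rw [Finset.card_singleton]; exact Finset.card_pos.2 ⟨t, ht⟩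
      have htS : t ∈ S := (Finset.mem_sdiff.1 ht).1
      have htc : t ∉ coloops M S := fun h => (Finset.mem_sdiff.1 ht).2 (Finset.mem_union.2 (Or.inl (hc₁ h)))
      have hsub' : S.erase t ⊆ B₁ ∪ B₂ := by
        intro e he
        by_contra hnot
        have : e ∈ S \ (B₁ ∪ B₂) := Finset.mem_sdiff.2 ⟨(Finset.mem_erase.1 he).2, hnot⟩
        rw [hsing, Finset.mem_singleton] at this
        exact (Finset.mem_erase.1 he).1 this
      have := rkN_mono (M := M) hsub'
      rw [rkN_erase_eq_of_nonColoop htS htc, rkN_eq_of_mem_shadowAt hS] at this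
      exact this
  -- submodularity on the closures
  have hsubm := rkN_inter_add_rkN_union_le (M := M) (clF M B₁) (clF M B₂)
  have hU : rkN M (B₁ ∪ B₂) ≤ rkN M (clF M B₁ ∪ clF M B₂) :=
    rkN_mono (Finset.union_subset_union (subset_clF (mem_membersIn.1 hB₁).1) (subset_clF (mem_membersIn.1 hB₂).1))
  rw [rkN_clF, rkN_clF, hr₁, hr₂] at hsubm
  have hF : rkN M (clF M B₁ ∩ clF M B₂) ≤ 3 := by omega
  -- `K ∪ X ⊆ cl B₁ ∩ cl B₂` with `X = {x} ∪ (G ∖ S)`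
  set X := insert x (G \ S) with hXdef
  have hXG : X ⊆ G := Finset.insert_subset (hSG hxS) Finset.sdiff_subset
  have hXK : Disjoint K X := by
    rw [Finset.disjoint_insert_right]
    refine ⟨hxK, ?_⟩
    rw [Finset.disjoint_left]
    intro e heK heP
    exact (Finset.mem_sdiff.1 heP).2 (coloops_subset_self S (coloopsG_subset_coloops hS heK))
  have hKX : K ∪ X ⊆ clF M B₁ ∩ clF M B₂ := by
    intro e he
    rw [Finset.mem_union] at he
    rw [Finset.mem_inter]
    rcases he with heK | heX
    · have hec : e ∈ coloops M S := by rw [hcol]; exact Finset.mem_insert_of_mem heK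
      exact ⟨subset_clF (mem_membersIn.1 hB₁).1 (hc₁ hec), subset_clF (mem_membersIn.1 hB₂).1 (hc₂ hec)⟩
    · rw [hXdef, Finset.mem_insert] at heX
      rcases heX with rfl | heP
      · exact ⟨subset_clF (mem_membersIn.1 hB₁).1 (hc₁ hxc), subset_clF (mem_membersIn.1 hB₂).1 (hc₂ hxc)⟩
      · exact ⟨hf₁ heP, hf₂ heP⟩
  have hY : ∀ y ∈ K, y ∈ G ∧ y ∉ clF M (G.erase y) := fun y hy => Finset.mem_filter.1 hy
  have hrX : rkN M X ≤ 2 := by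
    have h := eRk_union_coloops hGg K hY hXG hXK
    rw [eRk_eq_rkN, eRk_eq_rkN] at h
    have h' : rkN M (K ∪ X) = K.card + rkN M X := by exact_mod_cast h
    have := (rkN_mono (M := M) hKX).trans hF
    omega
  intro hmem
  have hr6 : rkN M (gr M \ S.erase x) = 6 := by
    have h := (mem_Uq.1 hmem).2.2
    rw [eRk_eq_rkN] at h
    exact_mod_cast h
  have hsub' : gr M \ S.erase x ⊆ X ∪ (gr M \ G) := by
    intro e he
    rw [Finset.mem_sdiff, Finset.mem_erase, not_and_or, not_not] at he
    rw [Finset.mem_union, hXdef, Finset.mem_insert, Finset.mem_sdiff, Finset.mem_sdiff]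
    by_cases heG : e ∈ G
    · left
      rcases he.2 with rfl | heS
      · exact Or.inl rfl
      · exact Or.inr ⟨heG, heS⟩
    · right
      exact ⟨he.1, heG⟩
  have h1 : rkN M (gr M \ S.erase x) ≤ rkN M (X ∪ (gr M \ G)) := rkN_mono hsub'
  have h2 := rkN_inter_add_rkN_union_le (M := M) X (gr M \ G)
  have h3 : rkN M (gr M \ G) ≤ 3 := hd ▸ rkN_le_card _
  omega

open scoped Classical in
/-- `L₁(S) ≤ [S ∖ x member] · req(S ∖ x)`: the `K`-deletion is layer-0 and the non-coloop deletions have rank `5`. -/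
theorem L1_le_req_erase_one (hG : G ∈ flatsQ M (4 + 1)) (hd : (gr M \ G).card = 3)
    (hS : S ∈ shadowAt M (4 + 2) 4 (Uq M (4 + 2) 4) G) {x : α}
    (hxK : x ∉ G.filter (fun y => y ∉ clF M (G.erase y)))
    (hcol : coloops M S = insert x (G.filter (fun y => y ∉ clF M (G.erase y)))) :
    L1 M 4 G S ≤ (if S.erase x ∈ membersIn M (Uq M (4 + 2) 4) G then req M 4 (S.erase x) else 0) := by
  set K := G.filter (fun y => y ∉ clF M (G.erase y)) with hKdef
  refine (L1_le_sum_erase hG hd hS).trans ?_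
  have hxc : x ∈ coloops M S := by rw [hcol]; exact Finset.mem_insert_self _ _
  have hsub : ({x} : Finset α) ⊆ S \ K := by
    intro e he
    rw [Finset.mem_singleton] at he
    rw [he]
    exact Finset.mem_sdiff.2 ⟨coloops_subset_self S hxc, hxK⟩
  have hzero : ∀ t ∈ S \ K, t ∉ ({x} : Finset α) →
      (if S.erase t ∈ membersIn M (Uq M (4 + 2) 4) G then req M 4 (S.erase t) else 0) = 0 := by
    intro t ht hnot
    rw [Finset.mem_singleton] at hnot
    rw [if_neg]
    intro hm
    have htc : t ∉ coloops M S := by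
      rw [hcol, Finset.mem_insert]
      rintro (h | h)
      · exact hnot h
      · exact (Finset.mem_sdiff.1 ht).2 h
    have hr5 : rkN M (S.erase t) = 5 := by
      rw [rkN_erase_eq_of_nonColoop (Finset.mem_sdiff.1 ht).1 htc, rkN_eq_of_mem_shadowAt hS]
    have hr4 : rkN M (S.erase t) = 4 := by
      have h := (mem_Uq.1 (mem_membersIn.1 hm).1).2.1
      rw [eRk_eq_rkN] at h
      exact_mod_cast h
    omega
  rw [← Finset.sum_subset hsub hzero, Finset.sum_singleton]

end TwoOneB

end PercRepro.Shadow
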